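import Literature.RingTheory.LocalCohomology.ConnectednessCore
import Literature.AlgebraicGeometry.Resolution.CoefficientRingsProofs
import Literature.AlgebraicGeometry.Resolution.ExcellentRingsCompleteUC
import Literature.AlgebraicGeometry.Resolution.DimensionFormula
import Literature.NumberTheory.Transcendental.NesterenkoLocalUnmixed
import Literature.RingTheory.KrullDimension.AffineDimension
import HarnessLib

/-!
# Grothendieck's connectedness theorem for a hypersurface in a complete local domain

Topic `Literature/RingTheory/LocalCohomology`. The geometric form of the core of SGA 2 XIII 2.1
(`ConnectednessCore.lean`): **for a complete Noetherian local domain `D` of dimension `d`, an element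
`g ∈ D` and a closed subset `Z = V(𝔠) ⊆ Spec D` of dimension `≤ d − 3`, the set `V(g) ∖ Z` is
connected** (`isPreconnected_zeroLocus_diff`). In Brodmann–Sharp's language: the connectedness
dimension of `D/gD` is at least `dim D − 2` (*Local cohomology*, 19.2, for a complete local domain and
a principal ideal).

Reduction to the core: by Cohen's structure theorem (Matsumura 29.4 (iii),
`Matsumura1987_29_4_iii_holds`) `D` is finite over a complete regular local subring `S`; the ideal
`𝔠 ∩ S` has `dim S/(𝔠 ∩ S) = dim D/𝔠 ≤ d − 3`, so (`S` being Cohen–Macaulay and catenary) it contains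
an `S`-regular sequence `x₁, x₂, x₃` (`exists_isRegular_three_of_dim`, prime avoidance against the
minimal primes of `(x₁, …, x_l)`, which have coheight `d − l`); enlarging `Z` to `V(x₁, x₂, x₃)` keeps
any disconnection alive because the generic points of `V(g)` have coheight `d − 1` (Krull's principal
ideal theorem and the dimension formula in the catenary domain `D`, complete local rings being
universally catenary, `isUniversallyCatenaryRing_of_isAdicComplete`). A disconnection of
`V(g) ∖ V(x)` by closed sets `V(𝔟₁)`, `V(𝔟₂)` then produces exactly the data excluded by
`grothendieck_core`.

Everything is proved; no definitions, no named facts.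

## References

* [Grothendieck1968SGA2] A. Grothendieck, SGA 2, Exp. XIII §2, Thm. 2.1 (arXiv:math/0511279, p. 95).
* [BrodmannSharp1998] M. Brodmann, R. Sharp, *Local cohomology*, CUP 1998, 19.2.
* [Matsumura1987] H. Matsumura, *Commutative Ring Theory*, Thm. 29.4 (iii), Thm. 17.4, §5 p. 31.
-/

noncomputable section

open IsLocalRing RingTheory.Sequence PrimeSpectrum Literature.AlgebraicGeometry.Resolution

universe u

namespace Literature.RingTheory.LocalCohomology

/-! ## Connectedness from a common specialisation or generalisation -/

section Specializes

variable {X : Type*} [TopologicalSpace X] {s : Set X} {x₀ : X}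

/-- A set all of whose points specialise to one of its points is preconnected. [folklore] -/
theorem isPreconnected_of_forall_specializes (hx₀ : x₀ ∈ s) (h : ∀ x ∈ s, x ⤳ x₀) :
    IsPreconnected s := by
  intro u v hu hv hsub ⟨p, hps, hpu⟩ ⟨q, hqs, hqv⟩
  rcases hsub hx₀ with h0 | h0
  · exact ⟨q, hqs, (h q hqs).mem_open hu h0, hqv⟩
  · exact ⟨p, hps, hpu, (h p hps).mem_open hv h0⟩

/-- A set one of whose points specialises to all of its points (a generic point) is preconnected.
[folklore] -/
theorem isPreconnected_of_forall_specializes' (hx₀ : x₀ ∈ s) (h : ∀ x ∈ s, x₀ ⤳ x) :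
    IsPreconnected s := by
  intro u v hu hv _ ⟨p, hps, hpu⟩ ⟨q, hqs, hqv⟩
  exact ⟨x₀, hx₀, (h p hps).mem_open hu hpu, (h q hqs).mem_open hv hqv⟩

/-- In the spectrum of a local ring, `V(g)` is preconnected (every point specialises to the closed
point). [folklore] -/
theorem isPreconnected_zeroLocus_singleton {R : Type u} [CommRing R] [IsLocalRing R] (g : R) :
    IsPreconnected (zeroLocus ({g} : Set R)) := by
  by_cases hg : IsUnit g
  · have : zeroLocus ({g} : Set R) = ∅ := by
      rw [Set.eq_empty_iff_forall_notMem]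
      intro p hp
      rw [mem_zeroLocus, Set.singleton_subset_iff] at hp
      exact p.2.ne_top (Ideal.eq_top_of_isUnit_mem _ hp hg)
    rw [this]
    exact isPreconnected_empty
  · refine isPreconnected_of_forall_specializes (x₀ := closedPoint R) ?_ fun p _ => ?_
    · rw [mem_zeroLocus, Set.singleton_subset_iff]
      exact (mem_maximalIdeal g).mpr hg
    · rw [← le_iff_specializes]
      exact IsLocalRing.le_maximalIdeal p.2.ne_top

end Specializes

/-! ## Dimension bookkeeping -/

section Dimension

variable {R : Type u} [CommRing R]

/-- **Dimension formula in a catenary Noetherian local domain**: `ht P + dim R/P = dim R`.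
[cite: Matsumura1987, §5 p. 31] -/
theorem height_add_ringKrullDim_quotient_eq [IsDomain R] [IsNoetherianRing R] [IsLocalRing R]
    (hR : IsCatenaryRing R) (P : Ideal R) [hP : P.IsPrime] :
    (P.height : WithBot ℕ∞) + ringKrullDim (R ⧸ P) = ringKrullDim R := by
  have hPm : P ≤ maximalIdeal R := IsLocalRing.le_maximalIdeal hP.ne_top
  have hform := hR.height_eq_height_add_height_map_quotientMk hPm
  haveI : Nontrivial (R ⧸ P) := Ideal.Quotient.nontrivial_iff.mpr hP.ne_top
  haveI : IsLocalRing (R ⧸ P) := .of_surjective' _ Ideal.Quotient.mk_surjective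
  rw [IsLocalRing.map_maximalIdeal_of_surjective _ Ideal.Quotient.mk_surjective] at hform
  rw [← IsLocalRing.maximalIdeal_height_eq_ringKrullDim,
    ← IsLocalRing.maximalIdeal_height_eq_ringKrullDim, hform, WithBot.coe_add]

/-- In a catenary Noetherian local domain of dimension `d`, a prime `P` of height `≤ h` which contains
an ideal `J` with `dim R/J + k ≤ d` has `h ≥ k` (`dim R/P = d − ht P ≤ dim R/J`). [folklore] -/
theorem le_height_of_le_of_ringKrullDim_le [IsDomain R] [IsNoetherianRing R] [IsLocalRing R]
    (hR : IsCatenaryRing R) {J P : Ideal R} [P.IsPrime] (hJP : J ≤ P) (k : ℕ) {d h : ℕ}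
    (hd : ringKrullDim R = d) (hP : P.height ≤ h) (hJ : ringKrullDim (R ⧸ J) + k ≤ d) : k ≤ h := by
  have hform := height_add_ringKrullDim_quotient_eq hR P
  haveI : Nontrivial (R ⧸ P) := Ideal.Quotient.nontrivial_iff.mpr (Ideal.IsPrime.ne_top ‹_›)
  haveI : IsLocalRing (R ⧸ P) := .of_surjective' _ Ideal.Quotient.mk_surjective
  obtain ⟨c, hc⟩ := exists_nat_cast_eq_ringKrullDim (R := R ⧸ P)
  obtain ⟨e, he⟩ := ENat.ne_top_iff_exists.mp (P.height_ne_top (Ideal.IsPrime.ne_top ‹_›))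
  rw [hc, hd, ← he] at hform
  have h1 : e + c = d := by
    have : ((e : ℕ∞) : WithBot ℕ∞) = ((e : ℕ) : WithBot ℕ∞) := rfl
    rw [this] at hform
    exact_mod_cast hform
  have h2 : e ≤ h := by
    rw [← he] at hP
    exact_mod_cast hP
  have h3 : ringKrullDim (R ⧸ P) ≤ ringKrullDim (R ⧸ J) :=
    ringKrullDim_le_of_surjective (Ideal.Quotient.factor hJP) (Ideal.Quotient.factor_surjective hJP)
  rw [hc] at h3
  -- `dim R/J` is a natural number `c' ≥ c` with `c' + k ≤ d`
  have h4 : (c : WithBot ℕ∞) + k ≤ d := le_trans (by gcongr) hJ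
  have h5 : c + k ≤ d := by exact_mod_cast h4
  omega

end Dimension

/-! ## A regular sequence of length three inside an ideal of large height -/

section RegularThree

variable {S : Type u} [CommRing S] [IsRegularLocalRing S]

/-- Prime avoidance inside an ideal: if `J ⊄ 𝔭` for every minimal prime `𝔭` of `(Q)`, some element
of `J` lies outside all of them. [folklore] -/
theorem exists_mem_notMem_minimalPrimes (J : Ideal S) (Q : List S)
    (hne : ∀ p ∈ (Ideal.ofList Q).minimalPrimes, ¬ J ≤ p) :
    ∃ y ∈ J, ∀ p ∈ (Ideal.ofList Q).minimalPrimes, y ∉ p := by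
  classical
  have hfin : (Ideal.ofList Q).minimalPrimes.Finite :=
    Ideal.finite_minimalPrimes_of_isNoetherianRing S _
  by_contra hcon
  push Not at hcon
  have hsub : ((J : Ideal S) : Set S) ⊆ ⋃ p ∈ (hfin.toFinset : Set (Ideal S)), (p : Set S) := by
    intro y hy
    obtain ⟨p, hp, hyp⟩ := hcon y hy
    exact Set.mem_biUnion (hfin.mem_toFinset.mpr hp) hyp
  obtain ⟨p, hp, hle⟩ := (Ideal.subset_union_prime (⊤ : Ideal S) (⊤ : Ideal S)
    (f := fun p : Ideal S => p) (fun p hp _ _ => (hfin.mem_toFinset.mp hp).1.1)).mp hsub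
  exact hne p (hfin.mem_toFinset.mp hp) hle

/-- **An ideal `J` of a regular local ring `S` all of whose primes `p ⊇ J` satisfy
`dim S/p + 3 ≤ dim S` contains an `S`-regular sequence of length `3`** (Cohen–Macaulay property:
elements of `J` avoiding the minimal primes of `(x₁, …, x_l)`, which have height `l` and coheight
`dim S − l`, exist by prime avoidance and form a regular sequence). [cite: Matsumura1987, Thm. 17.4] -/
theorem exists_isRegular_three_of_dim (J : Ideal S) (hJ : J ≠ ⊤)
    (hdim : ∀ p : Ideal S, p.IsPrime → J ≤ p → ringKrullDim (S ⧸ p) + 3 ≤ ringKrullDim S) :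
    ∃ x : Fin 3 → S, (∀ i, x i ∈ J) ∧ IsRegular S [x 0, x 1, x 2] := by
  classical
  haveI : IsDomain S := isDomain_of_isRegularLocalRing S
  have hcat : IsCatenaryRing S := isCatenaryRing_of_isRegularLocalRing S
  obtain ⟨rs, hrs, hrsm, hlen⟩ := exists_isRegular_length_eq_ringKrullDim S
  set d := rs.length with hd
  have hJm : J ≤ maximalIdeal S := IsLocalRing.le_maximalIdeal hJ
  -- one step of the construction
  have step : ∀ Q : List S, AvoidsMinimalPrimes Q → Q.length ≤ 2 →
      ∃ y ∈ J, ∀ p ∈ (Ideal.ofList Q).minimalPrimes, y ∉ p := by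
    intro Q hQ hQlen
    refine exists_mem_notMem_minimalPrimes J Q fun p hp hJp => ?_
    haveI := hp.1.1
    have hht : p.height = Q.length :=
      Literature.NumberTheory.Transcendental.Nesterenko.height_eq_length_of_mem_minimalPrimes_of_avoids
        p Q (fun L₁ e L₂ h 𝔮 h𝔮 _ => hQ L₁ e L₂ h 𝔮 h𝔮) hp le_rfl
    have hdim' : ringKrullDim (S ⧸ p) + ((3 : ℕ) : WithBot ℕ∞) ≤ d := by
      rw [hd, hlen]; exact_mod_cast hdim p hp.1.1 hJp
    have := le_height_of_le_of_ringKrullDim_le hcat le_rfl 3 hlen.symm hht.le hdim'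
    omega
  -- three steps
  have h0 : AvoidsMinimalPrimes ([] : List S) := by
    intro L₁ q L₂ h
    exact absurd (congrArg List.length h) (by simp)
  obtain ⟨y₁, hy₁J, hy₁⟩ := step [] h0 (by simp)
  have h1 : AvoidsMinimalPrimes [y₁] :=
    Literature.NumberTheory.Transcendental.Nesterenko.avoidsMinimalPrimes_append_singleton h0 hy₁
  obtain ⟨y₂, hy₂J, hy₂⟩ := step [y₁] h1 (by simp)
  have h2 : AvoidsMinimalPrimes [y₁, y₂] :=
    Literature.NumberTheory.Transcendental.Nesterenko.avoidsMinimalPrimes_append_singleton h1 hy₂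
  obtain ⟨y₃, hy₃J, hy₃⟩ := step [y₁, y₂] h2 (by simp)
  have h3 : AvoidsMinimalPrimes [y₁, y₂, y₃] :=
    Literature.NumberTheory.Transcendental.Nesterenko.avoidsMinimalPrimes_append_singleton h2 hy₃
  refine ⟨![y₁, y₂, y₃], fun i => ?_, ?_⟩
  · fin_cases i
    · exact hy₁J
    · exact hy₂J
    · exact hy₃J
  · have hQm : ∀ q ∈ [y₁, y₂, y₃], q ∈ maximalIdeal S := by
      intro q hq
      simp only [List.mem_cons, List.not_mem_nil, or_false] at hq
      rcases hq with rfl | rfl | rfl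
      · exact hJm hy₁J
      · exact hJm hy₂J
      · exact hJm hy₃J
    exact isRegular_of_forall_notMem_minimalPrimes hrs hrsm hlen hQm h3

end RegularThree

/-! ## The geometric statement -/

section Geometric

variable {D : Type u} [CommRing D] [IsDomain D] [IsNoetherianRing D] [IsLocalRing D]

/-- Generic points of a disconnecting piece: given `p ∈ V(g)` off `V(𝔠)` and off `V(𝔟')`, where
`V(g) ∖ V(𝔠) ⊆ V(𝔟) ∪ V(𝔟')`, a minimal prime `q ⊆ p` of `(g)` contains `𝔟 + (g)` but not
`𝔟' + (g)`, and — having coheight `≥ dim D − 1` (Krull, dimension formula) — does not contain any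
ideal `𝔠'` with `dim D/𝔠' + 3 ≤ dim D`. [folklore] -/
theorem exists_minimal_prime_witness (hcat : IsCatenaryRing D) {g : D}
    {𝔠 𝔠' 𝔟 𝔟' : Ideal D} {d : ℕ} (hd : ringKrullDim D = d)
    (h𝔠' : ringKrullDim (D ⧸ 𝔠') + 3 ≤ d)
    (hcover : ∀ q : PrimeSpectrum D, g ∈ q.asIdeal → ¬ 𝔠 ≤ q.asIdeal →
      𝔟 ≤ q.asIdeal ∨ 𝔟' ≤ q.asIdeal)
    {p : PrimeSpectrum D} (hpg : g ∈ p.asIdeal) (hp𝔠 : ¬ 𝔠 ≤ p.asIdeal) (hp𝔟' : ¬ 𝔟' ≤ p.asIdeal) :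
    ∃ q : Ideal D, q.IsPrime ∧ 𝔟 ⊔ Ideal.span {g} ≤ q ∧ ¬ 𝔟' ⊔ Ideal.span {g} ≤ q ∧ ¬ 𝔠' ≤ q := by
  obtain ⟨q, hq, hqp⟩ := Ideal.exists_minimalPrimes_le
    (show Ideal.span {g} ≤ p.asIdeal from (Ideal.span_singleton_le_iff_mem _).mpr hpg)
  haveI hqprime : q.IsPrime := hq.1.1
  have hgq : g ∈ q := hq.1.2 (Ideal.mem_span_singleton_self g)
  have hq𝔠 : ¬ 𝔠 ≤ q := fun h => hp𝔠 (h.trans hqp)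
  have hq𝔟' : ¬ 𝔟' ≤ q := fun h => hp𝔟' (h.trans hqp)
  have hq𝔟 : 𝔟 ≤ q := (hcover ⟨q, hqprime⟩ hgq hq𝔠).resolve_right hq𝔟'
  refine ⟨q, hqprime, sup_le hq𝔟 ((Ideal.span_singleton_le_iff_mem _).mpr hgq),
    fun h => hq𝔟' (le_sup_left.trans h), fun h𝔠'q => ?_⟩
  have hht : q.height ≤ 1 := Ideal.height_le_one_of_isPrincipal_of_mem_minimalPrimes _ q hq
  have h3 : ringKrullDim (D ⧸ 𝔠') + ((3 : ℕ) : WithBot ℕ∞) ≤ d := by exact_mod_cast h𝔠'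
  have := le_height_of_le_of_ringKrullDim_le hcat h𝔠'q 3 hd hht h3
  omega

/-- **Grothendieck's connectedness theorem for a hypersurface in a complete local domain**
(SGA 2 XIII 2.1 with `m = 1` for an integral `X`; Brodmann–Sharp 19.2): let `D` be a complete
Noetherian local domain, `g ∈ D`, and `𝔠` an ideal all of whose primes `𝔮 ⊇ 𝔠` satisfy
`dim D/𝔮 + 3 ≤ dim D` (i.e. `dim V(𝔠) ≤ dim D − 3`). Then `V(g) ∖ V(𝔠) ⊆ Spec D` is preconnected:
the punctured hypersurface `V(g) ∖ {𝔪}` cannot be disconnected by removing a closed subset of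
dimension `≤ dim D − 3`. [cite: Grothendieck1968SGA2, Exp. XIII Thm. 2.1] -/
theorem isPreconnected_zeroLocus_diff [IsAdicComplete (maximalIdeal D) D] (g : D) (𝔠 : Ideal D)
    (h𝔠 : ∀ 𝔮 : Ideal D, 𝔮.IsPrime → 𝔠 ≤ 𝔮 → ringKrullDim (D ⧸ 𝔮) + 3 ≤ ringKrullDim D) :
    IsPreconnected (zeroLocus ({g} : Set D) \ zeroLocus (𝔠 : Set D)) := by
  classical
  -- trivial cases: `𝔠 = ⊤` (nothing removed), `g = 0` (the whole spectrum)
  by_cases h𝔠top : 𝔠 = ⊤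
  · subst h𝔠top
    rw [show zeroLocus ((⊤ : Ideal D) : Set D) = ∅ from zeroLocus_empty_of_one_mem Submodule.mem_top,
      Set.sdiff_empty]
    exact isPreconnected_zeroLocus_singleton g
  by_cases hg : g = 0
  · subst hg
    by_cases h𝔠bot : 𝔠 ≤ (⊥ : Ideal D)
    · have : zeroLocus ({(0 : D)} : Set D) \ zeroLocus (𝔠 : Set D) = ∅ := by
        rw [Set.sdiff_eq_empty]
        intro p _
        rw [mem_zeroLocus, SetLike.coe_subset_coe]
        exact h𝔠bot.trans bot_le
      rw [this]
      exact isPreconnected_empty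
    · refine isPreconnected_of_forall_specializes' (x₀ := (⊥ : PrimeSpectrum D)) ?_ fun p _ => ?_
      · refine ⟨by rw [mem_zeroLocus, Set.singleton_subset_iff]; exact Submodule.zero_mem _, ?_⟩
        rw [mem_zeroLocus, SetLike.coe_subset_coe]
        exact h𝔠bot
      · rw [← le_iff_specializes]
        exact bot_le
  -- the dimension `d` of `D`; `D` is catenary
  obtain ⟨d, hd⟩ := exists_nat_cast_eq_ringKrullDim (R := D)
  have hcat : IsCatenaryRing D := (isUniversallyCatenaryRing_of_isAdicComplete D).isCatenaryRing
  have h𝔠m : 𝔠 ≤ maximalIdeal D := IsLocalRing.le_maximalIdeal h𝔠top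
  -- Cohen: `D` is finite over a complete regular local subring `S`
  obtain ⟨S, hSreg, -, hSfin⟩ := Matsumura1987_29_4_iii_holds D
  haveI := hSreg
  haveI := hSfin
  haveI : IsDomain S := isDomain_of_isRegularLocalRing S
  have hinjS : Function.Injective (algebraMap S D) := Subtype.val_injective
  have hdimD : ringKrullDim S = ringKrullDim D :=
    Literature.RingTheory.KrullDimension.ringKrullDim_eq_of_isIntegral hinjS
  -- `𝔠_S = 𝔠 ∩ S`; primes `p ⊇ 𝔠_S` lift to primes `𝔮 ⊇ 𝔠` with `dim S/p = dim D/𝔮` (going up)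
  set 𝔠S : Ideal S := 𝔠.comap (algebraMap S D) with h𝔠Sdef
  have h𝔠Stop : 𝔠S ≠ ⊤ := Ideal.comap_ne_top _ h𝔠top
  have hdimS : ∀ p : Ideal S, p.IsPrime → 𝔠S ≤ p → ringKrullDim (S ⧸ p) + 3 ≤ ringKrullDim S := by
    intro p hp hle
    obtain ⟨𝔮, h𝔮𝔠, h𝔮, rfl⟩ := Ideal.exists_ideal_over_prime_of_isIntegral p 𝔠 hle
    rw [Literature.RingTheory.KrullDimension.ringKrullDim_eq_of_isIntegral
      (Ideal.algebraMap_quotient_injective (I := 𝔮)), hdimD]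
    exact h𝔠 𝔮 h𝔮 h𝔮𝔠
  -- an `S`-regular sequence `x₁, x₂, x₃ ∈ 𝔠_S`, and `𝔠' = (x) D ⊆ 𝔠`
  obtain ⟨x, hx𝔠, hxreg⟩ := exists_isRegular_three_of_dim 𝔠S h𝔠Stop hdimS
  have hxm : ∀ i, algebraMap S D (x i) ∈ maximalIdeal D := fun i => h𝔠m (hx𝔠 i)
  set 𝔠' : Ideal D := Ideal.span (Set.range (yB D x)) with h𝔠'def
  have h𝔠'𝔠 : 𝔠' ≤ 𝔠 := by
    rw [h𝔠'def, Ideal.span_le]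
    rintro _ ⟨i, rfl⟩
    exact hx𝔠 i
  -- `dim D/𝔠' + 3 ≤ d`: `D/𝔠'` is finite over `S/(x)`, of dimension `d − 3`
  have hdim𝔠' : ringKrullDim (D ⧸ 𝔠') + 3 ≤ d := by
    set I : Ideal S := Ideal.ofList [x 0, x 1, x 2] with hIdef
    have hI : I ≤ 𝔠'.comap (algebraMap S D) := by
      rw [hIdef, Ideal.ofList, Ideal.span_le]
      intro r hr
      simp only [List.mem_cons, List.not_mem_nil, or_false, Set.mem_setOf_eq] at hr
      rw [SetLike.mem_coe, Ideal.mem_comap, h𝔠'def]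
      rcases hr with rfl | rfl | rfl <;> exact Ideal.subset_span (Set.mem_range_self _)
    have h1 : ringKrullDim (D ⧸ 𝔠') ≤ ringKrullDim (S ⧸ I) := by
      rw [← Literature.RingTheory.KrullDimension.ringKrullDim_eq_of_isIntegral
        (Ideal.algebraMap_quotient_injective (R := S) (I := 𝔠'))]
      exact ringKrullDim_le_of_surjective (Ideal.Quotient.factor hI)
        (Ideal.Quotient.factor_surjective hI)
    have h2 : ringKrullDim (S ⧸ I) + 3 = ringKrullDim S := by
      have := ringKrullDim_add_length_eq_ringKrullDim_of_isRegular [x 0, x 1, x 2] hxreg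
      simpa using this
    rw [← hd, ← hdimD, ← h2]
    gcongr
  have hd3 : 3 ≤ d := by
    haveI : Nontrivial (D ⧸ 𝔠') := Ideal.Quotient.nontrivial_iff.mpr
      (ne_top_of_le_ne_top h𝔠top h𝔠'𝔠)
    haveI : IsLocalRing (D ⧸ 𝔠') := .of_surjective' _ Ideal.Quotient.mk_surjective
    obtain ⟨c, hc⟩ := exists_nat_cast_eq_ringKrullDim (R := D ⧸ 𝔠')
    rw [hc] at hdim𝔠'
    have : c + 3 ≤ d := by exact_mod_cast hdim𝔠'
    omega
  -- a disconnection of `V(g) ∖ V(𝔠)` by closed sets `V(𝔟₁)`, `V(𝔟₂)`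
  rw [isPreconnected_iff_subset_of_disjoint_closed]
  intro u v hu hv hsub hdisj
  by_contra hnot
  push Not at hnot
  obtain ⟨hnu, hnv⟩ := hnot
  obtain ⟨𝔟₁, rfl⟩ := (isClosed_iff_zeroLocus_ideal u).mp hu
  obtain ⟨𝔟₂, rfl⟩ := (isClosed_iff_zeroLocus_ideal v).mp hv
  -- translation of the covering and disjointness into ideal-theoretic terms
  have hmemV : ∀ (q : PrimeSpectrum D) (I : Ideal D), q ∈ zeroLocus (I : Set D) ↔ I ≤ q.asIdeal :=
    fun q I => by rw [mem_zeroLocus, SetLike.coe_subset_coe]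
  have hmemg : ∀ q : PrimeSpectrum D, q ∈ zeroLocus ({g} : Set D) ↔ g ∈ q.asIdeal :=
    fun q => by rw [mem_zeroLocus, Set.singleton_subset_iff]; rfl
  have hcover : ∀ q : PrimeSpectrum D, g ∈ q.asIdeal → ¬ 𝔠 ≤ q.asIdeal →
      𝔟₁ ≤ q.asIdeal ∨ 𝔟₂ ≤ q.asIdeal := by
    intro q hgq h𝔠q
    have hq : q ∈ zeroLocus ({g} : Set D) \ zeroLocus (𝔠 : Set D) :=
      ⟨(hmemg q).mpr hgq, fun h => h𝔠q ((hmemV q 𝔠).mp h)⟩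
    rcases hsub hq with h | h
    · exact Or.inl ((hmemV q 𝔟₁).mp h)
    · exact Or.inr ((hmemV q 𝔟₂).mp h)
  have hdisj' : ∀ q : PrimeSpectrum D, g ∈ q.asIdeal → 𝔟₁ ≤ q.asIdeal → 𝔟₂ ≤ q.asIdeal →
      𝔠 ≤ q.asIdeal := by
    intro q hgq h1 h2
    by_contra h𝔠q
    have hq : q ∈ (zeroLocus ({g} : Set D) \ zeroLocus (𝔠 : Set D)) ∩
        (zeroLocus (𝔟₁ : Set D) ∩ zeroLocus (𝔟₂ : Set D)) :=
      ⟨⟨(hmemg q).mpr hgq, fun h => h𝔠q ((hmemV q 𝔠).mp h)⟩, (hmemV q 𝔟₁).mpr h1, (hmemV q 𝔟₂).mpr h2⟩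
    rw [hdisj] at hq
    exact hq
  -- the ideals of the two pieces
  set 𝔞₁ : Ideal D := 𝔟₁ ⊔ Ideal.span {g} with h𝔞₁def
  set 𝔞₂ : Ideal D := 𝔟₂ ⊔ Ideal.span {g} with h𝔞₂def
  have hg₁ : g ∈ 𝔞₁ := Ideal.mem_sup_right (Ideal.mem_span_singleton_self g)
  have hg₂ : g ∈ 𝔞₂ := Ideal.mem_sup_right (Ideal.mem_span_singleton_self g)
  -- `V(g) ⊆ V(𝔞₁ 𝔞₂ 𝔠')`
  have hcov : ∃ e : ℕ, (𝔞₁ * 𝔞₂ * 𝔠') ^ e ≤ Ideal.span {g} := by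
    refine Ideal.exists_pow_le_of_le_radical_of_fg ?_ (IsNoetherian.noetherian _)
    rw [← zeroLocus_subset_zeroLocus_iff]
    intro q hq
    rw [zeroLocus_span] at hq
    rw [hmemV]
    have hgq : g ∈ q.asIdeal := (hmemg q).mp hq
    by_cases h𝔠q : 𝔠' ≤ q.asIdeal
    · exact Ideal.mul_le_left.trans h𝔠q
    · rcases hcover q hgq (fun h => h𝔠q (h𝔠'𝔠.trans h)) with h | h
      · exact (Ideal.mul_le_right.trans Ideal.mul_le_right).trans
          (sup_le h ((Ideal.span_singleton_le_iff_mem _).mpr hgq))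
      · exact (Ideal.mul_le_right.trans Ideal.mul_le_left).trans
          (sup_le h ((Ideal.span_singleton_le_iff_mem _).mpr hgq))
  -- `V(𝔞₁) ∩ V(𝔞₂) ⊆ V(𝔠')`
  have hsep : ∀ i, ∃ L : ℕ, yB D x i ^ L ∈ 𝔞₁ ⊔ 𝔞₂ := by
    have hrad : 𝔠' ≤ (𝔞₁ ⊔ 𝔞₂).radical := by
      rw [← zeroLocus_subset_zeroLocus_iff]
      intro q hq
      rw [hmemV] at hq ⊢
      have hgq : g ∈ q.asIdeal := hq (Ideal.mem_sup_left hg₁)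
      exact h𝔠'𝔠.trans (hdisj' q hgq (le_sup_left.trans (le_sup_left.trans hq))
        (le_sup_left.trans (le_sup_right.trans hq)))
    intro i
    exact hrad (Ideal.subset_span (Set.mem_range_self i))
  -- generic points of the two pieces
  obtain ⟨p₁, hp₁s, hp₁v⟩ := Set.not_subset.mp hnv
  obtain ⟨p₂, hp₂s, hp₂u⟩ := Set.not_subset.mp hnu
  have hne𝔠' : ∀ {q : Ideal D}, ¬ 𝔠' ≤ q → ∃ i, yB D x i ∉ q := by
    intro q h
    by_contra hall
    push Not at hall
    exact h (by rw [h𝔠'def, Ideal.span_le]; rintro _ ⟨i, rfl⟩; exact hall i)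
  obtain ⟨Q₁, hQ₁, h₁, h₁', h₁c⟩ := exists_minimal_prime_witness hcat hd hdim𝔠' hcover
    ((hmemg p₁).mp hp₁s.1) (fun h => hp₁s.2 ((hmemV p₁ 𝔠).mpr h)) (fun h => hp₁v ((hmemV p₁ 𝔟₂).mpr h))
  obtain ⟨Q₂, hQ₂, h₂, h₂', h₂c⟩ := exists_minimal_prime_witness hcat hd hdim𝔠'
    (fun q hgq h𝔠q => (hcover q hgq h𝔠q).symm)
    ((hmemg p₂).mp hp₂s.1) (fun h => hp₂s.2 ((hmemV p₂ 𝔠).mpr h)) (fun h => hp₂u ((hmemV p₂ 𝔟₁).mpr h))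
  haveI := hQ₁
  haveI := hQ₂
  exact grothendieck_core hinjS x hxreg.toIsWeaklyRegular hxm hg hg₁ hg₂ hcov hsep
    h₁ h₁' (hne𝔠' h₁c) h₂ h₂' (hne𝔠' h₂c)

end Geometric

end Literature.RingTheory.LocalCohomology

end
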